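import Summits.AtomisticToContinuum.Crystallization.Theorems.FrustratedLawDichotomyStrainedPatchTableFloors

/-!
# TableFloorChain — the FLOOR CHAIN: the closed-form floor iteration lower-bounds every certified descent chain (lens-5 g79, sequel to `TableFloors`)

Same namespace as `…StrainedPatchTableFloors` (§1–§4: witness fields, closed-form feasibility, table floors, dipoles, STUCK-AT-THE-BOX, price floor).
Here: §5 ★★★ `floorChain_le_prices` — in the (HDIFF)/(DEVAL) stage format of `GradStep`, floor prices `Pf` generated stage by stage from witnesses
feasible against the FLOOR columns `σ + X + Pf i` satisfy `Pf i ≤ P i` at every maybe-reach row along EVERY certified chain `(G (i+1), P (i+1))_{i<n}`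
[PROVED · induction: column monotonicity at the sure-reach rows + `diffTab_floor` + `diffEval_mono`]; §6 ★★★ `stageChainG_floor_le_prices` — the same
in the RECORD format: GRADED pair-table stages `StageCertG` (g78 `coreOff_record_of_gradeTol_pairTabs`; g76's `StageCert` is the case `T = constTol τ`
by `stageCertG_of_stageCert`), with ★ `pairEval_mono` and the witnessed-floor predicate `Witnessed` (dipole on `(h, h′)`, dipole on `(Pm h′, h′)`,
tripole — closed-form row checks).  Consequence for the census (memo NODE-g79 §3, reading DIP-79): the LP-free floor iteration bounds every certified
stage price and the descent's fixed point from BELOW, cell by cell, before any LP of ④′ GRAD-77 is run; and every LP value must come out `≥` its floor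
(numerics guard).  Every theorem is formal bookkeeping over the g73–g78 host objects; nothing here asserts the summit or the T-leaf.
-/

namespace Summit.AtomisticToContinuum.Crystallization.Theorems.FrustratedLawDichotomyStrainedPatchTableFloors

open scoped BigOperators Classical RealInnerProductSpace
open Summit.AtomisticToContinuum.Crystallization.Theorems.FrustratedLawDichotomyMotifLemmas
open Summit.AtomisticToContinuum.Crystallization.Theorems.FrustratedLawDichotomyRangeCut
open Summit.AtomisticToContinuum.Crystallization.Theorems.FrustratedLawDichotomyAveragingCut
open Summit.AtomisticToContinuum.Crystallization.Theorems.FrustratedLawDichotomyStrainedPatchHomSplit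
open Summit.AtomisticToContinuum.Crystallization.Theorems.FrustratedLawDichotomyStrainedPatchQuantSlaving
open Summit.AtomisticToContinuum.Crystallization.Theorems.FrustratedLawDichotomyStrainedPatchHostCells
open Summit.AtomisticToContinuum.Crystallization.Theorems.FrustratedLawDichotomyStrainedPatchHostStep
open Summit.AtomisticToContinuum.Crystallization.Theorems.FrustratedLawDichotomyStrainedPatchRowPrice
open Summit.AtomisticToContinuum.Crystallization.Theorems.FrustratedLawDichotomyStrainedPatchGradStep
open Summit.AtomisticToContinuum.Crystallization.Theorems.FrustratedLawDichotomyStrainedPatchGradedTube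
open Summit.AtomisticToContinuum.Crystallization.Theorems.FrustratedLawDichotomyStrainedPatchGradedDescent
open Summit.AtomisticToContinuum.Crystallization.Theorems.FrustratedLawDichotomyStrainedPatchGradedStage

/-! ## §5. The floor chain: the closed-form floor iteration lower-bounds every certified descent chain -/

section Chain

variable {𝓘 : ChartFam} {τ σ r : ℝ} {H : HessTab} {F : ForceTab} {X : SlackTab} {B : E3 → E3 →L[ℝ] E3 →L[ℝ] E3} {tl : ℝ → ℝ → ℝ} {M₀ : ℕ}
  {z₀ : Fin M₀ → E3} {c₀ : Fin M₀} {O : Finset (Fin M₀)}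

/-- ★★★ **THE FLOOR CHAIN** — on an admissible occupancy `O` of an instance, let the census certify a descent chain in the (HDIFF)/(DEVAL) format
of `GradStep`: stage tables `G (i+1)` valid on the priced columns `σ + X + P i` with certified evaluations `diffEval(G (i+1)) ≤ P (i+1)`, `i < n`.
Let FLOOR DATA be given: floor prices `Pf` with `Pf 0 ≤ P 0` at the maybe-reach rows, floor tables `Gf (i+1) ≥ 0` on the near sets, evaluations
`Pf (i+1) ≤ diffEval(Gf (i+1))`, and for every stage and every (maybe-reach row, near partner) a witness field in the `τ`-box, off the centre,
feasible against the FLOOR column `σ + X + Pf i` [closed-form row checks], whose difference at the pair is `≥ Gf (i+1)` there.  THEN `Pf i ≤ P i` at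
every maybe-reach row for all `i ≤ n`: the census's LP-free floor iteration (memo NODE-g79 §2–§3, reading DIP-79) bounds every certified chain — and
its fixed point — from BELOW. [PROVED · induction on the stage: column monotonicity at the sure-reach rows + `diffTab_floor` + `diffEval_mono`;
the (DEVAL) bound is read on the zero reading] -/
theorem floorChain_le_prices (hT : TMono tl) (P Pf : ℕ → SlackTab) (G Gf : ℕ → DiffTab) (n : ℕ) (hI : 𝓘 M₀ z₀ c₀) (hO : AdmOcc τ z₀ c₀ O)
    (hτ : 0 ≤ τ) (hG : ∀ i, i < n → HostDiffTab 𝓘 τ σ r H F (addCol X (P i)) (G (i + 1)))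
    (hP : ∀ i, i < n → DiffEvalTab 𝓘 τ B tl r (G (i + 1)) (P (i + 1)))
    (h0 : ∀ h ∈ O, HostMaybeReach τ z₀ c₀ O h → Pf 0 M₀ z₀ c₀ h ≤ P 0 M₀ z₀ c₀ h)
    (hGf : ∀ i, ∀ h ∈ O, ∀ h' ∈ hostNear r z₀ O h, 0 ≤ Gf (i + 1) M₀ z₀ c₀ h h')
    (hEv : ∀ i, i < n → ∀ h ∈ O, HostMaybeReach τ z₀ c₀ O h → Pf (i + 1) M₀ z₀ c₀ h ≤ diffEval B tl r z₀ O (Gf (i + 1) M₀ z₀ c₀ h) h)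
    (hW : ∀ i, i < n → ∀ h ∈ O, HostMaybeReach τ z₀ c₀ O h → ∀ h' ∈ hostNear r z₀ O h, ∃ (S : Finset (Fin M₀)) (u : Fin M₀ → E3),
      S ⊆ O ∧ c₀ ∉ S ∧ (∀ k ∈ S, ‖u k‖ ≤ τ) ∧ WitnessFeasible τ σ H F (addCol X (Pf i)) z₀ c₀ O S u ∧
        Gf (i + 1) M₀ z₀ c₀ h h' ≤ ‖pinField S u h' - pinField S u h‖) :
    ∀ i, i ≤ n → ∀ h ∈ O, HostMaybeReach τ z₀ c₀ O h → Pf i M₀ z₀ c₀ h ≤ P i M₀ z₀ c₀ h := by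
  intro i
  induction i with
  | zero => exact fun _ => h0
  | succ i ih =>
    intro hi h hh hm
    have hi' : i < n := Nat.lt_of_succ_le hi
    have ihc : ∀ j ∈ O, HostSureReach τ z₀ c₀ O j → addCol X (Pf i) M₀ z₀ c₀ j ≤ addCol X (P i) M₀ z₀ c₀ j := fun j hj hs => by
      simp only [addCol]
      linarith [ih (Nat.le_of_lt hi') j hj (hostMaybeReach_of_sureReach hτ hs)]
    have hle : ∀ h' ∈ hostNear r z₀ O h, Gf (i + 1) M₀ z₀ c₀ h h' ≤ G (i + 1) M₀ z₀ c₀ h h' := fun h' hh' => by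
      obtain ⟨S, u, hS, hc, hu, hWf, hge⟩ := hW i hi' h hh hm h' hh'
      exact hge.trans (diffTab_floor (hG i hi') hI hO hS hc hτ hu (hWf.mono ihc) hh hm hh')
    exact (hEv i hi' h hh hm).trans ((diffEval_mono hT (hGf i h hh) hle).trans
      (hP i hi' M₀ z₀ c₀ hI O (fun _ => 0) (hostReading_zero hO hτ) h hh hm))

end Chain

/-! ## §6. The floor chain in the RECORD format: graded pair-table stages `StageCertG` (g78) / `StageCert` (g76) -/

/-- **`Witnessed τ T σ H F Y z₀ c₀ O v φ`** [INSTRUMENTABLE · closed-form row checks]: SOME finitely-supported witness field off the centre, in the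
`τ`-box and the graded boxes `T`, feasible against the column `Y`, has `v ≤ φ(field)` (the census's dipoles / tripoles, memo NODE-g79 §2). -/
def Witnessed (τ : ℝ) (T : SlackTab) (σ : ℝ) (H : HessTab) (F : ForceTab) (Y : SlackTab) {M₀ : ℕ} (z₀ : Fin M₀ → E3) (c₀ : Fin M₀)
    (O : Finset (Fin M₀)) (v : ℝ) (φ : (Fin M₀ → E3) → ℝ) : Prop :=
  ∃ (S : Finset (Fin M₀)) (u : Fin M₀ → E3), S ⊆ O ∧ c₀ ∉ S ∧ (∀ k ∈ S, ‖u k‖ ≤ τ) ∧ (∀ k ∈ S, ‖u k‖ ≤ T M₀ z₀ c₀ k) ∧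
    WitnessFeasible τ σ H F Y z₀ c₀ O S u ∧ v ≤ φ (pinField S u)

section RecordChain

variable {𝓘 : ChartFam} {τ σ r : ℝ} {T : SlackTab} {H : HessTab} {F : ForceTab} {X : SlackTab} {B : E3 → E3 →L[ℝ] E3 →L[ℝ] E3} {tl : ℝ → ℝ → ℝ}
  {Pm : PairMap} {M₀ : ℕ} {z₀ : Fin M₀ → E3} {c₀ : Fin M₀} {O : Finset (Fin M₀)} {h : Fin M₀}

/-- The ZERO field is a graded reading on any admissible occupancy (`0 ≤ τ`, `0 ≤ T` on `O`). [formal bookkeeping] -/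
theorem hostReadingG_zero (hO : AdmOcc τ z₀ c₀ O) (hτ : 0 ≤ τ) (hT : ∀ k ∈ O, 0 ≤ T M₀ z₀ c₀ k) : HostReadingG τ T z₀ c₀ O (fun _ => 0) :=
  ⟨hostReading_zero hO hτ, fun k hk => by rw [norm_zero]; exact hT k hk⟩

/-- ★ `pairEval` is MONOTONE in its three tables on the near set (nonnegative entries, `tl` monotone, `π` maps the near set into itself).
[formal bookkeeping] -/
theorem pairEval_mono (hT : TMono tl) {π : Fin M₀ → Fin M₀} (hπ : ∀ h' ∈ hostNear r z₀ O h, π h' ∈ hostNear r z₀ O h)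
    {g g' g₁ g₁' g₂ g₂' : Fin M₀ → ℝ} (h0 : ∀ h' ∈ hostNear r z₀ O h, 0 ≤ g h') (hle : ∀ h' ∈ hostNear r z₀ O h, g h' ≤ g' h')
    (h0₁ : ∀ h' ∈ hostNear r z₀ O h, 0 ≤ g₁ h') (hle₁ : ∀ h' ∈ hostNear r z₀ O h, g₁ h' ≤ g₁' h')
    (h0₂ : ∀ h' ∈ hostNear r z₀ O h, 0 ≤ g₂ h') (hle₂ : ∀ h' ∈ hostNear r z₀ O h, g₂ h' ≤ g₂' h') :
    pairEval B tl r z₀ O π g g₁ g₂ h ≤ pairEval B tl r z₀ O π g' g₁' g₂' h := by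
  unfold pairEval
  refine add_le_add (mul_le_mul_of_nonneg_left (Finset.sum_le_sum fun h' hh' => add_le_add ?_ ?_) (by norm_num))
    (Finset.sum_le_sum fun h' hh' => hT _ _ _ (h0 h' hh') (hle h' hh'))
  · exact mul_le_mul_of_nonneg_left (pow_le_pow_left₀ (h0 _ (hπ h' hh')) (hle _ (hπ h' hh')) 2)
      (norm_nonneg (B (z₀ h' - z₀ h) + B (z₀ (π h') - z₀ h)))
  · have hm : g₁ h' * g₂ h' ≤ g₁' h' * g₂' h' :=
      mul_le_mul (hle₁ h' hh') (hle₂ h' hh') (h0₂ h' hh') ((h0₁ h' hh').trans (hle₁ h' hh'))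
    rw [mul_assoc, mul_assoc]
    exact mul_le_mul_of_nonneg_left hm (norm_nonneg (B (z₀ h' - z₀ h)))

/-- ★★★ **THE FLOOR CHAIN IN THE RECORD FORMAT** — on an admissible occupancy `O` of an instance, let the census certify `n` GRADED stages
`StageCertG … (addCol X (P i)) (P (i+1))` (the stages of `coreOff_record_of_gradeTol_pairTabs`, g78; the record's `StageCert` stages of g76 are
the case `T = constTol τ` by `stageCertG_of_stageCert`).  Let FLOOR DATA be given: `Pf 0 ≤ P 0` at the maybe-reach rows; nonnegative floor
tables `Gf, G₁f, G₂f`; evaluations `Pf (i+1) ≤ pairEval(Pm; Gf, G₁f, G₂f)(i+1)`; and, per stage and per (maybe-reach row `h`, near partner `h′`), three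
WITNESSED floors against the FLOOR column `σ + X + Pf i` — a plain difference `≥ Gf`, an across-pair difference `≥ G₁f`, a second difference `≥ G₂f`
(dipole on `(h, h′)`, dipole on `(Pm h′, h′)`, tripole; closed-form row checks).  THEN `Pf i ≤ P i` at every maybe-reach row, `i ≤ n`.
[PROVED · induction on the stage: column monotonicity + `diffTabG_floor` / `pairTabG_floor` + `pairEval_mono` on the zero graded reading] -/
theorem stageChainG_floor_le_prices (hT : TMono tl) (hPm : PairAdm r Pm) (P Pf : ℕ → SlackTab) (Gf G₁f G₂f : ℕ → DiffTab) (n : ℕ)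
    (hI : 𝓘 M₀ z₀ c₀) (hO : AdmOcc τ z₀ c₀ O) (hτ : 0 ≤ τ) (hTO : ∀ k ∈ O, 0 ≤ T M₀ z₀ c₀ k)
    (hs : ∀ i, i < n → StageCertG 𝓘 τ T σ B tl r H F Pm (addCol X (P i)) (P (i + 1)))
    (h0 : ∀ h ∈ O, HostMaybeReach τ z₀ c₀ O h → Pf 0 M₀ z₀ c₀ h ≤ P 0 M₀ z₀ c₀ h)
    (hGf : ∀ i, ∀ h ∈ O, ∀ h' ∈ hostNear r z₀ O h,
      0 ≤ Gf (i + 1) M₀ z₀ c₀ h h' ∧ 0 ≤ G₁f (i + 1) M₀ z₀ c₀ h h' ∧ 0 ≤ G₂f (i + 1) M₀ z₀ c₀ h h')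
    (hEv : ∀ i, i < n → ∀ h ∈ O, HostMaybeReach τ z₀ c₀ O h → Pf (i + 1) M₀ z₀ c₀ h ≤
      pairEval B tl r z₀ O (Pm M₀ z₀ c₀ O h) (Gf (i + 1) M₀ z₀ c₀ h) (G₁f (i + 1) M₀ z₀ c₀ h) (G₂f (i + 1) M₀ z₀ c₀ h) h)
    (hW : ∀ i, i < n → ∀ h ∈ O, HostMaybeReach τ z₀ c₀ O h → ∀ h' ∈ hostNear r z₀ O h,
      Witnessed τ T σ H F (addCol X (Pf i)) z₀ c₀ O (Gf (i + 1) M₀ z₀ c₀ h h') (fun D => ‖D h' - D h‖) ∧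
      Witnessed τ T σ H F (addCol X (Pf i)) z₀ c₀ O (G₁f (i + 1) M₀ z₀ c₀ h h') (fun D => ‖D h' - D (Pm M₀ z₀ c₀ O h h')‖) ∧
      Witnessed τ T σ H F (addCol X (Pf i)) z₀ c₀ O (G₂f (i + 1) M₀ z₀ c₀ h h') (fun D => ‖D h' + D (Pm M₀ z₀ c₀ O h h') - (2 : ℝ) • D h‖)) :
    ∀ i, i ≤ n → ∀ h ∈ O, HostMaybeReach τ z₀ c₀ O h → Pf i M₀ z₀ c₀ h ≤ P i M₀ z₀ c₀ h := by
  intro i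
  induction i with
  | zero => exact fun _ => h0
  | succ i ih =>
    intro hi h hh hm
    have hi' : i < n := Nat.lt_of_succ_le hi
    obtain ⟨G, G₁, G₂, hG, hG₁₂, hP⟩ := hs i hi'
    have ihc : ∀ j ∈ O, HostSureReach τ z₀ c₀ O j → addCol X (Pf i) M₀ z₀ c₀ j ≤ addCol X (P i) M₀ z₀ c₀ j := fun j hj hsr => by
      simp only [addCol]
      linarith [ih (Nat.le_of_lt hi') j hj (hostMaybeReach_of_sureReach hτ hsr)]
    have hle : ∀ h' ∈ hostNear r z₀ O h, Gf (i + 1) M₀ z₀ c₀ h h' ≤ G M₀ z₀ c₀ h h' := fun h' hh' => by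
      obtain ⟨⟨S, u, hS, hc, hu, huT, hWf, hge⟩, -, -⟩ := hW i hi' h hh hm h' hh'
      exact hge.trans (diffTabG_floor hG hI hO hS hc hτ hu hTO huT (hWf.mono ihc) hh hm hh')
    have hle₁ : ∀ h' ∈ hostNear r z₀ O h, G₁f (i + 1) M₀ z₀ c₀ h h' ≤ G₁ M₀ z₀ c₀ h h' := fun h' hh' => by
      obtain ⟨-, ⟨S, u, hS, hc, hu, huT, hWf, hge⟩, -⟩ := hW i hi' h hh hm h' hh'
      exact hge.trans (pairTabG_floor hG₁₂ hI hO hS hc hτ hu hTO huT (hWf.mono ihc) hh hm hh').1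
    have hle₂ : ∀ h' ∈ hostNear r z₀ O h, G₂f (i + 1) M₀ z₀ c₀ h h' ≤ G₂ M₀ z₀ c₀ h h' := fun h' hh' => by
      obtain ⟨-, -, ⟨S, u, hS, hc, hu, huT, hWf, hge⟩⟩ := hW i hi' h hh hm h' hh'
      exact hge.trans (pairTabG_floor hG₁₂ hI hO hS hc hτ hu hTO huT (hWf.mono ihc) hh hm hh').2
    have hπ : ∀ h' ∈ hostNear r z₀ O h, Pm M₀ z₀ c₀ O h h' ∈ hostNear r z₀ O h := fun h' hh' => (hPm M₀ z₀ c₀ O h h' hh').1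
    exact (hEv i hi' h hh hm).trans ((pairEval_mono hT hπ (fun h' hh' => (hGf i h hh h' hh').1) hle
      (fun h' hh' => (hGf i h hh h' hh').2.1) hle₁ (fun h' hh' => (hGf i h hh h' hh').2.2) hle₂).trans
        (hP M₀ z₀ c₀ hI O (fun _ => 0) (hostReadingG_zero hO hτ hTO) h hh hm))

end RecordChain

end Summit.AtomisticToContinuum.Crystallization.Theorems.FrustratedLawDichotomyStrainedPatchTableFloors
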